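import Literature.NumberTheory.ComplexMultiplication.CMOrderGorensteinWeakClassesCount
import HarnessLib

/-!
# CM tori with endomorphism order EXACTLY `S`: `#` classes `= #ICM_S(𝔯) = #W̄k(S) · #Pic(S)`

Layer A3 of the Hodge/CM programme (docs/m5/MAPPING.md §1): the `K`-isomorphism classes of the CM tori
`(ℂ^Φ/D(𝔪), ι)` of type `(K, Φ)` built on lattices `𝔪 = ⊕ ℤμⱼ ⊂ K`.  Shimura [Shimura1998, §7.4 Prop. 17] counts the
tori whose order `ι⁻¹[End(A) ∩ ι(K)]` is the MAXIMAL order: there are `h_K` of them.  The files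
`CMTorusIsomorphismClassesOrderFinite` / `CMOrderIdealClassMonoidOverorderCount` count the tori whose order merely
CONTAINS a fixed order `𝔯 = endOrder (M_{μ₁})` (by `#ICM(𝔯) = Σ_S #ICM_S(𝔯)`).  This file is the exact-order refinement
for an ARBITRARY over-order `S ⊇ 𝔯`, in any degree:

* `coe_div_self_eq_coe_endOrder` — the order of the torus on `⊕ ℤνⱼ` is the multiplicator ring `(N:N)` of the
  `𝔯`-ideal `N = ⊕ ℤνⱼ` [Marseglia2019, §2];
* `nonempty_quot_smul_span_eq_equiv_quot_stratum` — classes mod `K^×` of lattices with order exactly `S`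
  `≃ ICM_S(𝔯) = {[I] : (I:I) = S}` [Marseglia2019, §4];
* `natCard_quot_exists_bijective_comm_eq_natCard_quot_stratum` — the `K`-isomorphism classes of CM tori of type
  `(K, Φ)` with order exactly `S` number `#ICM_S(𝔯)`;
* `natCard_quot_exists_bijective_comm_eq_natCard_quot_weak_mul_natCard_quot_pic` — hence `= #W̄k(S) · #Pic(S)`
  [Marseglia2019, Thm. 4.6];
* `natCard_quot_exists_bijective_comm_eq_natCard_quot_pic_iff_forall_div_div_eq` — and `= #Pic(S)` IF AND ONLY IF
  `S` is Gorenstein [Marseglia2019, §4 remark after Def. 4.2; BuchmannLenstra1994, Prop. 2.7] — Shimura's Prop. 17 is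
  the case `S = 𝓞_K` (`#Pic(𝓞_K) = h_K`).

Carrier conventions as in `CMOrderWeakClassesCount`: the stratum is `{M ≠ 0 // ↑(M/M) = S}`, isomorphism is
`M = x·N` (`x ≠ 0`), weak equivalence is `1 ∈ (M:N)(N:M)`, `Pic(S)` is the stratum elements with `L·(S:L) = S`;
«`S` Gorenstein» is `∀ I ≠ 0, M I = I → (M:(M:I)) = I` for the idempotent `M = MM ≠ 0` with `↑M = S`.
Theorems only (no new definitions, no named facts).

## References
* [Marseglia2019] S. Marseglia, *Computing the ideal class monoid of an order*, J. Lond. Math. Soc. 101 (2020),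
  arXiv:1805.09671 — §2 (multiplicator ring), §4 Prop. 4.1, Def. 4.2, Thm. 4.6, pp. 4, 8–9.
* [Shimura1998] G. Shimura, *Abelian varieties with complex multiplication and modular functions*, PUP 1998 —
  §6.1 p. 40, §7.4 Props. 15–17 p. 58.
* [BuchmannLenstra1994] J. A. Buchmann, H. W. Lenstra Jr., *Approximating rings of integers in number fields*,
  JTNB 6 (1994) — §2 Prop. 2.7, p. 230.
* [DadeTausskyZassenhaus1962] E. C. Dade, O. Taussky, H. Zassenhaus, *On the theory of orders …*, Math. Ann. 148 (1962).
* [MilneCM2006] J. S. Milne, *Complex multiplication*, 2006 — Ch. I Prop. 3.17.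
-/

noncomputable section

open scoped Classical nonZeroDivisors NumberField Pointwise
open NumberField Module FractionalIdeal

namespace Literature.NumberTheory.ComplexMultiplication

open Literature.AlgebraicGeometry.Motives (CMType)
open Literature.AlgebraicGeometry.ComplexMultiplication (CMTorus.periodEquiv)
open Literature.Geometry.Kaehler
open Literature.Geometry.Kaehler.ComplexTorus (mapMatrix)

namespace CMTypeLattice

section ExactOrder

variable {K : Type} [Field K] [NumberField K]
variable {ι : Type} [Fintype ι] [DecidableEq ι] (μ₁ : Basis ι ℚ K)

omit [Fintype ι] [DecidableEq ι] in
/-- `a𝔪 = 𝔪′` forces `a ≠ 0` (`𝔪′` spans `K`; bookkeeping). [cite: Marseglia2019, §3 Cor. 3.4, p. 6] -/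
private theorem ne_zero_of_smul_span_eq'' (μ μ' : Basis ι ℚ K) {a : K}
    (ha : a • Submodule.span ℤ (Set.range μ) = Submodule.span ℤ (Set.range μ')) : a ≠ 0 := by
  rintro rfl
  obtain ⟨j⟩ := μ'.index_nonempty
  have hj : μ' j ∈ (0 : K) • Submodule.span ℤ (Set.range μ) := by
    rw [ha]
    exact Submodule.subset_span ⟨j, rfl⟩
  obtain ⟨m, -, hm⟩ := (Submodule.mem_smul_pointwise_iff_exists _ _ _).1 hj
  exact μ'.ne_zero j (by rw [← hm, zero_smul])

omit [NumberField K] [Fintype ι] [DecidableEq ι] in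
/-- `x·N = x • N` as subsets of `K` (bookkeeping). [cite: Marseglia2019, §3 Cor. 3.4 («`I = αJ`»), p. 6] -/
private theorem coe_spanSingleton_mul'' {R : Type*} [CommRing R] {S : Submonoid R} [Algebra R K]
    [IsLocalization S K] (x : K) (I : FractionalIdeal S K) : ((spanSingleton S x * I : FractionalIdeal S K) : Set K) = x • (I : Set K) := by
  ext y
  rw [SetLike.mem_coe, mem_singleton_mul, Set.mem_smul_set]
  exact ⟨fun ⟨y', hy', h⟩ => ⟨y', hy', h.symm⟩, fun ⟨y', hy', h⟩ => ⟨y', hy', h.symm⟩⟩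

variable [IsFractionRing (endOrder (Algebra.leftMulMatrix μ₁)) K]

/-- **The multiplicator ring of an `𝔯`-stable lattice is its order: if `↑N = ⊕ ℤνⱼ` then `(N : N) = endOrder (M_ν)`**
as subsets of `K` (`x ∈ (N:N) ⟺ xN ⊆ N ⟺ x·⊕ℤνⱼ ⊆ ⊕ℤνⱼ`; Shimura's order `ι⁻¹[End(A) ∩ ι(F)]` of the torus
`ℂ^Φ/D(⊕ℤνⱼ)` IS the multiplicator ring of `N`). [cite: Shimura1998, §6.1 (the order of `(A, ι)`), p. 40]
[cite: Marseglia2019, §2 («`(I:I)` … is called the multiplicator ring of `I`»), p. 4] -/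
theorem coe_div_self_eq_coe_endOrder {N : FractionalIdeal (endOrder (Algebra.leftMulMatrix μ₁))⁰ K} (hN : N ≠ 0)
    {ν : Basis ι ℚ K} (h : (N : Set K) = (Submodule.span ℤ (Set.range ν) : Set K)) :
    ((N / N : FractionalIdeal (endOrder (Algebra.leftMulMatrix μ₁))⁰ K) : Set K) =
      (endOrder (Algebra.leftMulMatrix ν) : Set K) := by
  have hmem : ∀ y : K, y ∈ N ↔ y ∈ Submodule.span ℤ (Set.range ν) := fun y => by
    rw [← SetLike.mem_coe, h, SetLike.mem_coe]
  ext x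
  rw [SetLike.mem_coe, SetLike.mem_coe, mem_div_iff_of_ne_zero hN, mem_endOrder_leftMulMatrix_iff_forall]
  exact ⟨fun hx y hy => (hmem _).1 (hx y ((hmem y).2 hy)), fun hx y hy => (hmem _).2 (hx y ((hmem y).1 hy))⟩

/-- **The classes modulo `K^×` of the lattices `⊕ ℤνⱼ ⊂ K` whose order is EXACTLY the over-order `S ⊇ 𝔯` are in
bijection with the stratum `ICM_S(𝔯) = {[I] : (I:I) = S}`** (the stratum version of
`CMTorusIsomorphismClassesOrderFinite.nonempty_quot_smul_span_eq_equiv_quot_fractionalIdeal`: `[⊕ℤμⱼ] ↦ [𝔯𝔪 = 𝔪]`,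
whose multiplicator ring is the order of `𝔪`). [cite: Marseglia2019, §4 («`ICM(R) = ⊔ ICM_S`»), p. 9]
[cite: DadeTausskyZassenhaus1962, title theorem] -/
theorem nonempty_quot_smul_span_eq_equiv_quot_stratum (S : Subring K) :
    Nonempty ((Quot fun μ μ' : {μ : Basis ι ℚ K //
        endOrder (Algebra.leftMulMatrix μ₁) ≤ endOrder (Algebra.leftMulMatrix μ) ∧ endOrder (Algebra.leftMulMatrix μ) = S} =>
          ∃ a : K, a • Submodule.span ℤ (Set.range (μ : Basis ι ℚ K)) =
            Submodule.span ℤ (Set.range (μ' : Basis ι ℚ K))) ≃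
      Quot fun M N : {M : FractionalIdeal (endOrder (Algebra.leftMulMatrix μ₁))⁰ K //
          M ≠ 0 ∧ ((M / M : FractionalIdeal (endOrder (Algebra.leftMulMatrix μ₁))⁰ K) : Set K) = S} =>
        ∃ x : K, x ≠ 0 ∧ (M : FractionalIdeal (endOrder (Algebra.leftMulMatrix μ₁))⁰ K) =
          spanSingleton (endOrder (Algebra.leftMulMatrix μ₁))⁰ x * N) := by
  -- `μ ↦ 𝔯𝔪`
  have hFex := fun μ : {μ : Basis ι ℚ K // endOrder (Algebra.leftMulMatrix μ₁) ≤ endOrder (Algebra.leftMulMatrix μ) ∧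
      endOrder (Algebra.leftMulMatrix μ) = S} => exists_fractionalIdeal_coe_eq (Algebra.leftMulMatrix μ₁) (μ : Basis ι ℚ K) μ.2.1
  have hFS : ∀ μ : {μ : Basis ι ℚ K // endOrder (Algebra.leftMulMatrix μ₁) ≤ endOrder (Algebra.leftMulMatrix μ) ∧
      endOrder (Algebra.leftMulMatrix μ) = S},
      (((hFex μ).choose / (hFex μ).choose : FractionalIdeal (endOrder (Algebra.leftMulMatrix μ₁))⁰ K) : Set K) = S := fun μ => by
    rw [coe_div_self_eq_coe_endOrder μ₁ (hFex μ).choose_spec.1 (hFex μ).choose_spec.2, μ.2.2]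
  let F : {μ : Basis ι ℚ K // endOrder (Algebra.leftMulMatrix μ₁) ≤ endOrder (Algebra.leftMulMatrix μ) ∧
      endOrder (Algebra.leftMulMatrix μ) = S} →
      {M : FractionalIdeal (endOrder (Algebra.leftMulMatrix μ₁))⁰ K //
        M ≠ 0 ∧ ((M / M : FractionalIdeal (endOrder (Algebra.leftMulMatrix μ₁))⁰ K) : Set K) = S} := fun μ =>
    ⟨(hFex μ).choose, (hFex μ).choose_spec.1, hFS μ⟩
  have hF : ∀ μ, ((F μ : FractionalIdeal (endOrder (Algebra.leftMulMatrix μ₁))⁰ K) : Set K) =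
      (Submodule.span ℤ (Set.range (μ : Basis ι ℚ K)) : Set K) := fun μ => (hFex μ).choose_spec.2
  -- `N ↦` a `ℤ`-basis of `N`
  have hGex := fun N : {M : FractionalIdeal (endOrder (Algebra.leftMulMatrix μ₁))⁰ K //
      M ≠ 0 ∧ ((M / M : FractionalIdeal (endOrder (Algebra.leftMulMatrix μ₁))⁰ K) : Set K) = S} =>
    exists_basis_le_endOrder_and_coe_eq μ₁ N.2.1
  have hGS : ∀ N : {M : FractionalIdeal (endOrder (Algebra.leftMulMatrix μ₁))⁰ K //
      M ≠ 0 ∧ ((M / M : FractionalIdeal (endOrder (Algebra.leftMulMatrix μ₁))⁰ K) : Set K) = S},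
      endOrder (Algebra.leftMulMatrix (hGex N).choose) = S := fun N =>
    SetLike.coe_injective (by rw [← coe_div_self_eq_coe_endOrder μ₁ N.2.1 (hGex N).choose_spec.2, N.2.2])
  let G : {M : FractionalIdeal (endOrder (Algebra.leftMulMatrix μ₁))⁰ K //
      M ≠ 0 ∧ ((M / M : FractionalIdeal (endOrder (Algebra.leftMulMatrix μ₁))⁰ K) : Set K) = S} →
      {μ : Basis ι ℚ K // endOrder (Algebra.leftMulMatrix μ₁) ≤ endOrder (Algebra.leftMulMatrix μ) ∧
        endOrder (Algebra.leftMulMatrix μ) = S} := fun N =>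
    ⟨(hGex N).choose, (hGex N).choose_spec.1, hGS N⟩
  have hG : ∀ N : {M : FractionalIdeal (endOrder (Algebra.leftMulMatrix μ₁))⁰ K //
      M ≠ 0 ∧ ((M / M : FractionalIdeal (endOrder (Algebra.leftMulMatrix μ₁))⁰ K) : Set K) = S},
      ((N : FractionalIdeal (endOrder (Algebra.leftMulMatrix μ₁))⁰ K) : Set K) =
      (Submodule.span ℤ (Set.range ((G N : Basis ι ℚ K))) : Set K) := fun N => (hGex N).choose_spec.2
  refine ⟨⟨Quot.lift (fun μ => Quot.mk _ (F μ)) ?_, Quot.lift (fun N => Quot.mk _ (G N)) ?_, ?_, ?_⟩⟩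
  · -- `a𝔪 = 𝔪′ ⟹ 𝔯𝔪′ = a·𝔯𝔪`
    rintro μ μ' ⟨a, ha⟩
    refine (Quot.sound ⟨a, ne_zero_of_smul_span_eq'' (μ : Basis ι ℚ K) (μ' : Basis ι ℚ K) ha, ?_⟩).symm
    apply SetLike.coe_injective
    rw [coe_spanSingleton_mul'', hF, hF, ← ha, Submodule.coe_pointwise_smul]
  · -- `M = xN ⟹ L(M) = x·L(N)`
    rintro M N ⟨x, -, hx⟩
    refine (Quot.sound ⟨x, ?_⟩).symm
    apply SetLike.coe_injective
    rw [Submodule.coe_pointwise_smul, ← hG, ← hG, hx, coe_spanSingleton_mul'']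
  · -- `L(𝔯𝔪) = 𝔪`
    intro q
    induction q using Quot.ind with
    | mk μ =>
      change Quot.mk _ (G (F μ)) = Quot.mk _ μ
      refine (Quot.sound ⟨1, ?_⟩).symm
      apply SetLike.coe_injective
      rw [Submodule.coe_pointwise_smul, one_smul, ← hG, hF]
  · -- `𝔯·L(N) = N`
    intro q
    induction q using Quot.ind with
    | mk N =>
      change Quot.mk _ (F (G N)) = Quot.mk _ N
      congr 1
      apply Subtype.ext
      apply SetLike.coe_injective
      rw [hF, ← hG]

/-- **`#`(classes of lattices with order EXACTLY `S`) `= #ICM_S(𝔯)`.** [cite: Marseglia2019, §4 («`ICM(R) = ⊔ ICM_S`»), p. 9] -/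
theorem natCard_quot_smul_span_eq_eq_natCard_quot_stratum (S : Subring K) :
    Nat.card (Quot fun μ μ' : {μ : Basis ι ℚ K //
        endOrder (Algebra.leftMulMatrix μ₁) ≤ endOrder (Algebra.leftMulMatrix μ) ∧ endOrder (Algebra.leftMulMatrix μ) = S} =>
          ∃ a : K, a • Submodule.span ℤ (Set.range (μ : Basis ι ℚ K)) =
            Submodule.span ℤ (Set.range (μ' : Basis ι ℚ K))) =
      Nat.card (Quot fun M N : {M : FractionalIdeal (endOrder (Algebra.leftMulMatrix μ₁))⁰ K //
          M ≠ 0 ∧ ((M / M : FractionalIdeal (endOrder (Algebra.leftMulMatrix μ₁))⁰ K) : Set K) = S} =>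
        ∃ x : K, x ≠ 0 ∧ (M : FractionalIdeal (endOrder (Algebra.leftMulMatrix μ₁))⁰ K) =
          spanSingleton (endOrder (Algebra.leftMulMatrix μ₁))⁰ x * N) :=
  Nat.card_congr (nonempty_quot_smul_span_eq_equiv_quot_stratum μ₁ S).some

/-- **TORUS LEVEL — the CM tori of type `(K, Φ)` whose endomorphism order is EXACTLY `S`: the `K`-isomorphism classes
of the tori `(ℂ^Φ/D(𝔪), ι)`, `𝔪 = ⊕ ℤμⱼ` with `ι⁻¹[End ∩ ι(K)] = endOrder (M_μ) = S` (`S ⊇ 𝔯` an over-order of the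
fixed order `𝔯 = endOrder (M_{μ₁})`), are as many as the stratum `ICM_S(𝔯)`** (the EXACT-order refinement of
`CMTorusIsomorphismClassesOrderFinite.natCard_quot_exists_bijective_comm_eq`, which counts `ι(𝔯) ⊆ End` by `#ICM(𝔯)`).
[cite: Shimura1998, §7.4 Props. 15–17 (the classes of `(A, ι)` with a given order), p. 58] [cite: Marseglia2019, §4 Thm. 4.6, p. 9]
[cite: MilneCM2006, Ch. I Prop. 3.17] -/
theorem natCard_quot_exists_bijective_comm_eq_natCard_quot_stratum (Φ : CMType K) (S : Subring K) :
    Nat.card (Quot fun μ μ' : {μ : Basis ι ℚ K //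
        endOrder (Algebra.leftMulMatrix μ₁) ≤ endOrder (Algebra.leftMulMatrix μ) ∧ endOrder (Algebra.leftMulMatrix μ) = S} =>
      ∃ A : Matrix ι ι ℤ,
        Function.Bijective
            (mapMatrix (CMTorus.periodEquiv Φ (μ : Basis ι ℚ K)) (CMTorus.periodEquiv Φ (μ' : Basis ι ℚ K)) A) ∧
          ∀ α : K, A.map (Int.cast : ℤ → ℚ) * Algebra.leftMulMatrix (μ : Basis ι ℚ K) α =
            Algebra.leftMulMatrix (μ' : Basis ι ℚ K) α * A.map (Int.cast : ℤ → ℚ)) =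
      Nat.card (Quot fun M N : {M : FractionalIdeal (endOrder (Algebra.leftMulMatrix μ₁))⁰ K //
          M ≠ 0 ∧ ((M / M : FractionalIdeal (endOrder (Algebra.leftMulMatrix μ₁))⁰ K) : Set K) = S} =>
        ∃ x : K, x ≠ 0 ∧ (M : FractionalIdeal (endOrder (Algebra.leftMulMatrix μ₁))⁰ K) =
          spanSingleton (endOrder (Algebra.leftMulMatrix μ₁))⁰ x * N) := by
  rw [← natCard_quot_smul_span_eq_eq_natCard_quot_stratum μ₁ S]
  exact Nat.card_congr (Quot.congrRight fun μ μ' =>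
    exists_bijective_comm_iff_exists_smul_span_eq Φ (μ : Basis ι ℚ K) (μ' : Basis ι ℚ K))

variable [Nonempty ι]

/-- **THEOREM 4.6 at torus level: the CM tori of type `(K, Φ)` with endomorphism order EXACTLY `S` fall into
`#W̄k(S) · #Pic(S)` `K`-isomorphism classes** — for every order `𝔯` and every over-order `S`, in any degree.
[cite: Marseglia2019, §4 Thm. 4.6, p. 9] [cite: Shimura1998, §7.4 Prop. 17, p. 58] -/
theorem natCard_quot_exists_bijective_comm_eq_natCard_quot_weak_mul_natCard_quot_pic (Φ : CMType K) (S : Subring K) :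
    Nat.card (Quot fun μ μ' : {μ : Basis ι ℚ K //
        endOrder (Algebra.leftMulMatrix μ₁) ≤ endOrder (Algebra.leftMulMatrix μ) ∧ endOrder (Algebra.leftMulMatrix μ) = S} =>
      ∃ A : Matrix ι ι ℤ,
        Function.Bijective
            (mapMatrix (CMTorus.periodEquiv Φ (μ : Basis ι ℚ K)) (CMTorus.periodEquiv Φ (μ' : Basis ι ℚ K)) A) ∧
          ∀ α : K, A.map (Int.cast : ℤ → ℚ) * Algebra.leftMulMatrix (μ : Basis ι ℚ K) α =
            Algebra.leftMulMatrix (μ' : Basis ι ℚ K) α * A.map (Int.cast : ℤ → ℚ)) =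
    Nat.card (Quot fun M N : {M : FractionalIdeal (endOrder (Algebra.leftMulMatrix μ₁))⁰ K //
        M ≠ 0 ∧ ((M / M : FractionalIdeal (endOrder (Algebra.leftMulMatrix μ₁))⁰ K) : Set K) = S} =>
      (1 : K) ∈ (M : FractionalIdeal (endOrder (Algebra.leftMulMatrix μ₁))⁰ K) / N * (N / M)) *
    Nat.card (Quot fun L N : {L : FractionalIdeal (endOrder (Algebra.leftMulMatrix μ₁))⁰ K //
        (L ≠ 0 ∧ ((L / L : FractionalIdeal (endOrder (Algebra.leftMulMatrix μ₁))⁰ K) : Set K) = S) ∧ L * (L / L / L) = L / L} =>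
      ∃ x : K, x ≠ 0 ∧ (L : FractionalIdeal (endOrder (Algebra.leftMulMatrix μ₁))⁰ K) =
        spanSingleton (endOrder (Algebra.leftMulMatrix μ₁))⁰ x * N) := by
  rw [natCard_quot_exists_bijective_comm_eq_natCard_quot_stratum μ₁ Φ S,
    EndOrder.natCard_quot_stratum_eq_natCard_quot_weak_mul_natCard_quot_pic S]

/-- **The Gorenstein case («exactly `h` abelian varieties», with `h ↦ #Pic(S)`): the CM tori of type `(K, Φ)` with
endomorphism order EXACTLY the over-order `S = ↑M` (`M = MM ≠ 0`) number `#Pic(S)` classes IF AND ONLY IF `S` is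
Gorenstein** (`(M:(M:I)) = I` for all `M`-ideals; e.g. `S = 𝓞_K`: Shimura's Prop. 17 `h = h_K`; every monogenic /
quadratic `S`). [cite: Shimura1998, §7.4 Prop. 17, p. 58] [cite: Marseglia2019, §4 Thm. 4.6 with the remark after Def. 4.2, pp. 8–9]
[cite: BuchmannLenstra1994, §2 Prop. 2.7, p. 230] -/
theorem natCard_quot_exists_bijective_comm_eq_natCard_quot_pic_iff_forall_div_div_eq (Φ : CMType K)
    {M : FractionalIdeal (endOrder (Algebra.leftMulMatrix μ₁))⁰ K} (hMM : M * M = M) (hM0 : M ≠ 0) {S : Subring K}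
    (hMS : (M : Set K) = S) :
    Nat.card (Quot fun μ μ' : {μ : Basis ι ℚ K //
        endOrder (Algebra.leftMulMatrix μ₁) ≤ endOrder (Algebra.leftMulMatrix μ) ∧ endOrder (Algebra.leftMulMatrix μ) = S} =>
      ∃ A : Matrix ι ι ℤ,
        Function.Bijective
            (mapMatrix (CMTorus.periodEquiv Φ (μ : Basis ι ℚ K)) (CMTorus.periodEquiv Φ (μ' : Basis ι ℚ K)) A) ∧
          ∀ α : K, A.map (Int.cast : ℤ → ℚ) * Algebra.leftMulMatrix (μ : Basis ι ℚ K) α =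
            Algebra.leftMulMatrix (μ' : Basis ι ℚ K) α * A.map (Int.cast : ℤ → ℚ)) =
    Nat.card (Quot fun L N : {L : FractionalIdeal (endOrder (Algebra.leftMulMatrix μ₁))⁰ K //
        (L ≠ 0 ∧ ((L / L : FractionalIdeal (endOrder (Algebra.leftMulMatrix μ₁))⁰ K) : Set K) = S) ∧ L * (L / L / L) = L / L} =>
      ∃ x : K, x ≠ 0 ∧ (L : FractionalIdeal (endOrder (Algebra.leftMulMatrix μ₁))⁰ K) =
        spanSingleton (endOrder (Algebra.leftMulMatrix μ₁))⁰ x * N) ↔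
    ∀ I : FractionalIdeal (endOrder (Algebra.leftMulMatrix μ₁))⁰ K, I ≠ 0 → M * I = I → M / (M / I) = I := by
  rw [natCard_quot_exists_bijective_comm_eq_natCard_quot_stratum μ₁ Φ S,
    natCard_quot_stratum_eq_natCard_quot_pic_iff_forall_div_div_eq μ₁ hMM hM0 hMS]

end ExactOrder

end CMTypeLattice

end Literature.NumberTheory.ComplexMultiplication
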